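import Summits.QuantumAdvantage.QuantumAdvantage.Theorems.RandomOracleGaugeDecoupledCoreAAL1FamilyBooleanCorner
import HarnessLib

/-!
# Crux `DecoupledCoreAA` (stmt-QuantumAdvantage-17872), line `l1-family`, stub `stub_l1Family` —
# the TOP-MASS regime `V = 1` IS the Boolean corner; the registered statement holds in the regime `κ₀ = 0, K₀ ≤ 1`

For an ℓ¹-bounded family (`Σ_i |g_i(z)| ≤ 1` pointwise) the total mass `V = Σ_i E[g_i²]` is at most `1`
(`Σ_i g_i(z)² ≤ max_i |g_i(z)| · Σ_i |g_i(z)| ≤ 1`), with EQUALITY exactly for SIGNED PARTITIONS (at every `z` one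
member is `±1` and the others vanish).  So the regime `(κ₀, K₀) = (0, K₀ ≤ 1)` of `stub_l1Family` — hypothesis
`1 ≤ K₀ · d⁰ · V`, i.e. `V = 1` — is precisely the Boolean corner of `…L1FamilyBooleanCorner`, where the dichotomy holds
at scale `1/(256 d³)`.  The open content of the stub is therefore the ROBUSTNESS of the Boolean corner from `V = 1` down
to `V ≥ 1/(K₀ d^κ₀)` (already to `V ≥ 1/2`), exactly as for `PseudoBoundedAA` ("the crux is the robustness of its
Boolean corner to the top variance band", `CornerLift.pseudoBoundedAA_iff_topBand`).

* `sum_sq_le_one_of_l1` (`Σ_i g_i(z)² ≤ 1`), `signedPartition_of_topMass` (`V ≥ 1` ⟹ signed partition),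
* `l1Family_topMass` — `V ≥ 1 ⟹ (∃ i, E[g_i²] ≥ 1/(256d³)) ∨ (∃ j, Σ_i E[(g_i − g_i^{⊕j})²] ≥ 1/(64d³))`,
* `l1Family_regime_zero` — the registered statement's body for `κ₀ = 0` and every `0 < K₀ ≤ 1`, `(c, C) = (3, 1/256)`.

Honest label: identifies one regime of the registered stub with a known corner; the stub (all regimes) stays open.
Sources: O'Donnell–Saks–Schramm–Servedio 2005 Thm 1.1; O'Donnell–Zhao arXiv:1512.01603 eqn. (2.1).
-/

-- D-0017: single-conjunct summit ⇒ the duplicate `QuantumAdvantage.QuantumAdvantage` is mandated.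
set_option linter.dupNamespace false

noncomputable section

open Finset
open Literature.Computability.QuantumComplexity
open Summit.QuantumAdvantage.QuantumAdvantage.Cruxes.DecoupledCoreAA.L1Family.Address (sum_boolAvg_eq)
open Summit.QuantumAdvantage.QuantumAdvantage.Cruxes.DecoupledCoreAA.L1Family.BooleanCorner (l1Family_signedPartition)

namespace Summit.QuantumAdvantage.QuantumAdvantage.Cruxes.DecoupledCoreAA.L1Family.TopMass

variable {N : ℕ}

/-- **Pointwise `Σ_i g_i(z)² ≤ 1`** for an ℓ¹-bounded family (each `|g_i| ≤ Σ|g_k| ≤ 1`, so `g_i² ≤ |g_i|`). [folklore] -/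
theorem sum_sq_le_one_of_l1 {ι : Type*} [Fintype ι] (a : ι → ℝ) (h : ∑ i, |a i| ≤ 1) :
    ∑ i, a i ^ 2 ≤ 1 := by
  have hle : ∀ i, |a i| ≤ 1 := fun i =>
    (Finset.single_le_sum (fun k _ => abs_nonneg (a k)) (Finset.mem_univ i)).trans h
  calc ∑ i, a i ^ 2 = ∑ i, |a i| * |a i| := Finset.sum_congr rfl fun i _ => by rw [← sq_abs, sq]
    _ ≤ ∑ i, |a i| * 1 := Finset.sum_le_sum fun i _ => mul_le_mul_of_nonneg_left (hle i) (abs_nonneg _)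
    _ ≤ 1 := by simpa using h

/-- Real numbers with `Σ|a_i| ≤ 1` and `Σ a_i² = 1` form a signed unit vector: one `|a_i| = 1`, the rest `0`. [folklore] -/
theorem exists_unique_abs_eq_one {ι : Type*} [Fintype ι] [DecidableEq ι] (a : ι → ℝ) (h1 : ∑ i, |a i| ≤ 1)
    (h2 : ∑ i, a i ^ 2 = 1) : ∃ i, |a i| = 1 ∧ ∀ k, k ≠ i → a k = 0 := by
  have hle : ∀ i, |a i| ≤ 1 := fun i =>
    (Finset.single_le_sum (fun k _ => abs_nonneg (a k)) (Finset.mem_univ i)).trans h1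
  -- `Σ (|a_i| − a_i²) ≤ 0` with nonnegative terms: every `|a_i| ∈ {0,1}` and `Σ|a_i| = 1`
  have hterm0 : ∀ i, 0 ≤ |a i| - a i ^ 2 := by
    intro i; rw [← sq_abs]; nlinarith [hle i, abs_nonneg (a i)]
  have hsum0 : ∑ i, (|a i| - a i ^ 2) = 0 := by
    apply le_antisymm
    · rw [Finset.sum_sub_distrib, h2]; linarith
    · exact Finset.sum_nonneg fun i _ => hterm0 i
  have heach : ∀ i, |a i| - a i ^ 2 = 0 := fun i =>
    (Finset.sum_eq_zero_iff_of_nonneg fun k _ => hterm0 k).mp hsum0 i (Finset.mem_univ i)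
  have h01 : ∀ i, a i = 0 ∨ |a i| = 1 := by
    intro i
    have h := heach i
    rw [← sq_abs] at h
    have : |a i| * (1 - |a i|) = 0 := by nlinarith [h]
    rcases mul_eq_zero.mp this with h0 | h0
    · left; exact abs_eq_zero.mp h0
    · right; linarith
  have habs1 : ∑ i, |a i| = 1 := by
    apply le_antisymm h1
    calc (1 : ℝ) = ∑ i, a i ^ 2 := h2.symm
      _ ≤ ∑ i, |a i| := Finset.sum_le_sum fun i _ => by linarith [heach i]
  -- some `|a_i| = 1`
  have hex : ∃ i, |a i| = 1 := by
    by_contra hne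
    push Not at hne
    have hall : ∀ i, a i = 0 := fun i => (h01 i).resolve_right (hne i)
    have : ∑ i, |a i| = 0 := Finset.sum_eq_zero fun i _ => by rw [hall i, abs_zero]
    linarith
  obtain ⟨i, hi⟩ := hex
  refine ⟨i, hi, fun k hki => ?_⟩
  rcases h01 k with hk | hk
  · exact hk
  · exfalso
    have h2le : |a i| + |a k| ≤ ∑ l, |a l| := by
      have hpair : ∑ l ∈ ({i, k} : Finset ι), |a l| = |a i| + |a k| := Finset.sum_pair (Ne.symm hki)
      rw [← hpair]
      exact Finset.sum_le_sum_of_subset_of_nonneg (by simp) fun l _ _ => abs_nonneg _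
    linarith

/-- **Top mass forces a signed partition.**  If `Σ_i |g_i(z)| ≤ 1` pointwise and the total mass
`Σ_i E[g_i²]` is at least `1`, then at every point exactly one member is `±1` and all others vanish.
[cite: ODonnellZhao2016, eqn. (2.1)] -/
theorem signedPartition_of_topMass (g : Fin N → MvPolynomial (Fin N) ℝ)
    (hl1 : ∀ z, ∑ i, |evalBool (g i) z| ≤ 1) (hV : 1 ≤ ∑ i, boolAvg (fun z => evalBool (g i) z ^ 2)) :
    ∀ z, ∃ i, |evalBool (g i) z| = 1 ∧ ∀ k, k ≠ i → evalBool (g k) z = 0 := by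
  classical
  -- the pointwise sums of squares are `≤ 1` and average to `≥ 1`, hence are all `= 1`
  set s : (Fin N → Bool) → ℝ := fun z => ∑ i, evalBool (g i) z ^ 2 with hs
  have hsle : ∀ z, s z ≤ 1 := fun z => sum_sq_le_one_of_l1 _ (hl1 z)
  have havg : 1 ≤ boolAvg s := by rw [hs, ← sum_boolAvg_eq]; exact hV
  have hall : ∀ z, s z = 1 := by
    have h2N : (0 : ℝ) < (2 : ℝ) ^ N := by positivity
    have hsum : (2 : ℝ) ^ N ≤ ∑ z, s z := by
      unfold boolAvg at havg
      rwa [le_div_iff₀ h2N, one_mul] at havg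
    have hcard : ∑ _z : Fin N → Bool, (1 : ℝ) = (2 : ℝ) ^ N := by
      simp [Finset.card_univ, Fintype.card_bool, Fintype.card_fin]
    have hzero : ∑ z, (1 - s z) = 0 := by
      apply le_antisymm
      · rw [Finset.sum_sub_distrib, hcard]; linarith
      · exact Finset.sum_nonneg fun z _ => by linarith [hsle z]
    intro z
    have := (Finset.sum_eq_zero_iff_of_nonneg fun w _ => by linarith [hsle w]).mp hzero z (Finset.mem_univ z)
    linarith
  intro z
  exact exists_unique_abs_eq_one (fun i => evalBool (g i) z) (hl1 z) (hall z)

/-- **`stub_l1Family` at top mass.**  An ℓ¹-bounded family of degree `≤ d` (`d ≥ 1`) with total mass `≥ 1` satisfies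
`(∃ i, E[g_i²] ≥ 1/(256 d³)) ∨ (∃ j, Σ_i E[(g_i − g_i^{⊕j})²] ≥ 1/(64 d³))` (it is a signed partition; Boolean
corner). [cite: OdonnellEtAl2005, Thm 1.1] [cite: ODonnellZhao2016, eqn. (2.1)] -/
theorem l1Family_topMass {N d : ℕ} (g : Fin N → MvPolynomial (Fin N) ℝ) (hd : 1 ≤ d)
    (hdeg : ∀ i, (g i).totalDegree ≤ d) (hl1 : ∀ z, ∑ i, |evalBool (g i) z| ≤ 1)
    (hV : 1 ≤ ∑ i, boolAvg (fun z => evalBool (g i) z ^ 2)) :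
    (∃ i, 1 / (256 * (d : ℝ) ^ 3) ≤ boolAvg (fun z => evalBool (g i) z ^ 2)) ∨
    (∃ j, 1 / (64 * (d : ℝ) ^ 3) ≤
      ∑ i, boolAvg (fun z => (evalBool (g i) z - evalBool (g i) (flipBit j z)) ^ 2)) :=
  l1Family_signedPartition g hd hdeg (signedPartition_of_topMass g hl1 hV)

/-- **The registered statement of `stub_l1Family` HOLDS in the regime `κ₀ = 0`, `0 < K₀ ≤ 1`** (there the
hypothesis `1 ≤ K₀ · d⁰ · V` forces `V = 1`, the Boolean corner), with `(c, C) := (3, 1/256)`.  The open content of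
the stub is the regime `K₀ d^κ₀ > 1`. [cite: OdonnellEtAl2005, Thm 1.1] [cite: ODonnellZhao2016, Thm. 2.13] -/
theorem l1Family_regime_zero (K₀ : ℝ) (hK₀ : 0 < K₀) (hK₁ : K₀ ≤ 1) :
    ∃ (c : ℕ) (C : ℝ), 0 < C ∧
      ∀ (N d : ℕ) (g : Fin N → MvPolynomial (Fin N) ℝ), 1 ≤ d → (∀ i, (g i).totalDegree ≤ d) →
        (∀ z, ∑ i, |evalBool (g i) z| ≤ 1) →
        1 ≤ K₀ * (d : ℝ) ^ (0 : ℕ) * ∑ i, boolAvg (fun z => evalBool (g i) z ^ 2) →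
        (∃ i, C / (d : ℝ) ^ c ≤ boolAvg (fun z => evalBool (g i) z ^ 2)) ∨
        (∃ j, C / (d : ℝ) ^ c ≤
          ∑ i, boolAvg (fun z => (evalBool (g i) z - evalBool (g i) (flipBit j z)) ^ 2)) := by
  refine ⟨3, 1 / 256, by norm_num, ?_⟩
  intro N d g hd hdeg hl1 hreg
  have hV0 : 0 ≤ ∑ i, boolAvg (fun z => evalBool (g i) z ^ 2) :=
    Finset.sum_nonneg fun i _ => boolAvg_nonneg fun _ => sq_nonneg _
  have hV : 1 ≤ ∑ i, boolAvg (fun z => evalBool (g i) z ^ 2) := by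
    rw [pow_zero, mul_one] at hreg
    nlinarith
  have hd0 : (0 : ℝ) < (d : ℝ) ^ 3 := by
    have : (0 : ℝ) < (d : ℝ) := by exact_mod_cast hd
    positivity
  rcases l1Family_topMass g hd hdeg hl1 hV with ⟨i, hi⟩ | ⟨j, hj⟩
  · left
    refine ⟨i, le_trans (le_of_eq ?_) hi⟩
    field_simp
  · right
    refine ⟨j, le_trans ?_ hj⟩
    rw [div_div]
    apply div_le_div_of_nonneg_left (by norm_num) (by positivity)
    linarith

end Summit.QuantumAdvantage.QuantumAdvantage.Cruxes.DecoupledCoreAA.L1Family.TopMass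

end
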